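import Summits.CriticalPhenomena.PercolationContinuityZ3.Theorems.PercNearOneGluingNoHeavyQuantGluedWindowIneq
import Summits.CriticalPhenomena.PercolationContinuityZ3.Theorems.PercNearOneGluingNoHeavyQuantGluedWindowTwoHeavy
import Mathlib.Tactic.FieldSimp
import HarnessLib

/-!
# QUANT lane R8, T-DEC: the two heavy-row cells of LEMMA W's two-column criterion as REAL INEQUALITIES (arm-1 gen 59, architect)

builds on p205010 (kernel theorem, internal audit signed; external expert review pending)

Support file (`--supports stmt-CriticalPhenomena-4575`), QUANT lane seat prim-quant-arm-1 (gen 59); memo `run/shared/lean/prim/quant/prim-quant-arm-1-g59/ARCH-G59.md`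
§0 (6), §3.  Pure real algebra, theorems only, standard axioms, no sorries.  For the cell "both lower copies of the low atom heavy" of
`gluedPullback_windowPair_lowTriple_heavyHeavy` (`…QuantGluedWindowHeavyHeavy`): the breakpoint inequalities B1 (`cell_B1_real`: chord inequality +
`heavy_row_ineq` at `τ = 1 − t₂`) and B0 (`cell_B0_twoHeavy_real`: chord inequality + the Handelman-certified `two_heavy_rows_ineq`, via the identities
`κ_s − F(ρ_s) = (κ_s − u)·y/(1 + y − ρ_s)` and `D_b/z_b ≤ ((ρ_b−y)/(ρ_a−y))·D_a/z_a`).  `κ₂` is the (light) rate of the top copy, any real here.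

HONEST STATUS.  Real-algebra infrastructure; `GluedLemmaW` (flow form), `GluedDominatedMass`, the band, `SiblingStep`, `FarTreeRow` OPEN; RATE class (log\*) /
honest sentence of `run/shared/lean/prim/quant/README.md` unchanged.  [this work].  Nothing here is cited as a published result.  The gluing rows served
[cite: KozmaNitzan2024, Conjecture 3 (p. 15)]; product measure [cite: Grimmett1999, §1.3 p. 10].
-/

namespace Summit.CriticalPhenomena.PercolationContinuityZ3.Theorems
namespace Quant
namespace LawDec
namespace GluedWindow

set_option maxHeartbeats 2000000 in
/-- **cell B1 as a real inequality** (the breakpoint `θ = u/κ₁` of the two-column criterion when the middle copy is heavy): from the chord inequality in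
`F`-form and the regime facts, `W(t₀+t₁)u·H_b + W t₂κ₂ u ≤ γ·As·u + γ(1−As)·H_b` (`H_b = ρ_b/(1−ρ_b)`, `W = 1−γ`, `u = y/(1−y)`). [this work] -/
theorem cell_B1_real (y t0 t1 t2 ρ₀ ρa ρb κ2 As : ℝ) (hy0 : 0 < y) (hy1 : y < 1) (h1y : 0 < 1 - y) (hyt2 : y ≤ t2)
    (ht0p : 0 ≤ t0) (ht1p : 0 ≤ t1) (hts : t0 + t1 + t2 = 1) (hρ₀y : ρ₀ < y) (hρay : y < ρa) (hρa1 : ρa < 1) (hρby : y < ρb) (hρb1 : ρb < 1)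
    (hρba : ρb ≤ ρa) (_hF1 : ρa * (1 + t0) ≤ 2 * ρ₀) (hF2 : ρb * (2 - t2) ≤ 2 * ρ₀) (hPs : y ≤ 1 - As) (_hAs : t2 ≤ 1 - As) (hρ₀0 : 0 ≤ ρ₀)
    (hP2 : (1 - (y ^ 2 + (1 - y) * ρ₀)) * (t0 * ((y ^ 2 + (1 - y) * ρa) / (1 - (y ^ 2 + (1 - y) * ρa)))
      + t1 * ((y ^ 2 + (1 - y) * ρb) / (1 - (y ^ 2 + (1 - y) * ρb))) + t2 * κ2) ≤ y ^ 2 + (1 - y) * ρ₀) :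
    (1 - (y ^ 2 + (1 - y) * ρ₀)) * (t0 + t1) * (y / (1 - y)) * (ρb / (1 - ρb))
      + (1 - (y ^ 2 + (1 - y) * ρ₀)) * t2 * κ2 * (y / (1 - y))
      ≤ (y ^ 2 + (1 - y) * ρ₀) * As * (y / (1 - y)) + (y ^ 2 + (1 - y) * ρ₀) * (1 - As) * (ρb / (1 - ρb)) := by
  have hza : 0 < 1 + y - ρa := by linarith only [hρa1, hy0]
  have hzb' : 0 < 1 + y - ρb := by linarith only [hρb1, hy0]
  have hzst : 0 < 1 + y - ρ₀ := by linarith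
  have eγ1 : 1 - (y ^ 2 + (1 - y) * ρ₀) = (1 - y) * (1 + y - ρ₀) := by ring
  have hγ1 : 0 ≤ 1 - (y ^ 2 + (1 - y) * ρ₀) := by rw [eγ1]; positivity
  have hρa1' : 0 < 1 - ρa := by linarith only [hρa1]
  have hρb1' : 0 < 1 - ρb := by linarith only [hρb1]
  have huκa : y / (1 - y) ≤ ρa / (1 - ρa) := by rw [div_le_div_iff₀ h1y hρa1']; linarith only [hρay, hy1, hρa1]
  have huHb : y / (1 - y) ≤ ρb / (1 - ρb) := by rw [div_le_div_iff₀ h1y hρb1']; linarith only [hρby, hy1, hρb1]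
  have hu0 : 0 ≤ y / (1 - y) := div_nonneg hy0.le h1y.le
  have Wu : (1 - (y ^ 2 + (1 - y) * ρ₀)) * (y / (1 - y)) = y * (1 + y - ρ₀) := by rw [eγ1]; field_simp
  have eFa : (y ^ 2 + (1 - y) * ρa) / (1 - (y ^ 2 + (1 - y) * ρa)) = ρa / (1 - ρa) - (ρa / (1 - ρa) - y / (1 - y)) * y / (1 + y - ρa) := by
    have e1 : 1 - (y ^ 2 + (1 - y) * ρa) = (1 - y) * (1 + y - ρa) := by ring
    rw [e1]; field_simp; ring
  have eFb : (y ^ 2 + (1 - y) * ρb) / (1 - (y ^ 2 + (1 - y) * ρb)) = ρb / (1 - ρb) - (ρb / (1 - ρb) - y / (1 - y)) * y / (1 + y - ρb) := by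
    have e1 : 1 - (y ^ 2 + (1 - y) * ρb) = (1 - y) * (1 + y - ρb) := by ring
    rw [e1]; field_simp; ring
  have eDa : ρa / (1 - ρa) - y / (1 - y) = (ρa - y) / ((1 - ρa) * (1 - y)) := by field_simp; ring
  have eDb : ρb / (1 - ρb) - y / (1 - y) = (ρb - y) / ((1 - ρb) * (1 - y)) := by field_simp; ring
  have hDa : 0 ≤ ρa / (1 - ρa) - y / (1 - y) := by linarith only [huκa]
  have hDb : 0 ≤ ρb / (1 - ρb) - y / (1 - y) := by linarith only [huHb]
  have HRb := GluedWindow.heavy_row_ineq y (1 - t2) ρ₀ ρb hy0 hy1 hρby.le hρb1.le (by linarith only [hts, ht0p, ht1p]) (by linarith only [hyt2]) (by linarith only [hF2]) hρ₀y.le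
  have coreB : (1 - t2) * y ^ 2 * (1 + y - ρ₀) ≤ (1 - As) * (y ^ 2 + (1 - y) * ρ₀) * (1 + y - ρb) := by
    have m := mul_le_mul HRb hPs hy0.le (by positivity)
    nlinarith only [m]
  have hFaFb : (y ^ 2 + (1 - y) * ρb) / (1 - (y ^ 2 + (1 - y) * ρb)) ≤ (y ^ 2 + (1 - y) * ρa) / (1 - (y ^ 2 + (1 - y) * ρa)) := by
    have ea : 1 - (y ^ 2 + (1 - y) * ρa) = (1 - y) * (1 + y - ρa) := by ring
    have eb : 1 - (y ^ 2 + (1 - y) * ρb) = (1 - y) * (1 + y - ρb) := by ring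
    rw [ea, eb, div_le_div_iff₀ (mul_pos h1y hzb') (mul_pos h1y hza)]
    have e2 : (y ^ 2 + (1 - y) * ρa) * ((1 - y) * (1 + y - ρb)) - (y ^ 2 + (1 - y) * ρb) * ((1 - y) * (1 + y - ρa)) = (1 - y) * (ρa - ρb) := by ring
    have e3 := mul_nonneg h1y.le (sub_nonneg.2 hρba)
    linarith only [e2, e3]
  have hFb : (1 - (y ^ 2 + (1 - y) * ρ₀)) * ((t0 + t1) * ((y ^ 2 + (1 - y) * ρb) / (1 - (y ^ 2 + (1 - y) * ρb)))
      + t2 * κ2) ≤ y ^ 2 + (1 - y) * ρ₀ := by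
    have := mul_le_mul_of_nonneg_left (mul_le_mul_of_nonneg_left hFaFb ht0p) hγ1
    linarith [hP2]
  rw [eFb] at hFb
  have step1b := mul_le_mul_of_nonneg_right hFb hu0
  have step2b : (1 - (y ^ 2 + (1 - y) * ρ₀)) * (t0 + t1) * (y / (1 - y)) * ((ρb / (1 - ρb) - y / (1 - y)) * y / (1 + y - ρb))
      ≤ (y ^ 2 + (1 - y) * ρ₀) * (1 - As) * (ρb / (1 - ρb) - y / (1 - y)) := by
    have e1 : (1 - (y ^ 2 + (1 - y) * ρ₀)) * (t0 + t1) * (y / (1 - y)) * ((ρb / (1 - ρb) - y / (1 - y)) * y / (1 + y - ρb))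
        = ((1 - t2) * y ^ 2 * (1 + y - ρ₀)) * ((ρb / (1 - ρb) - y / (1 - y)) / (1 + y - ρb)) := by
      rw [eγ1, show t0 + t1 = 1 - t2 by linarith only [hts]]; field_simp
    have e2 : (y ^ 2 + (1 - y) * ρ₀) * (1 - As) * (ρb / (1 - ρb) - y / (1 - y))
        = ((1 - As) * (y ^ 2 + (1 - y) * ρ₀) * (1 + y - ρb)) * ((ρb / (1 - ρb) - y / (1 - y)) / (1 + y - ρb)) := by field_simp
    rw [e1, e2]
    exact mul_le_mul_of_nonneg_right coreB (div_nonneg hDb hzb'.le)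
  have eFb' : (1 - (y ^ 2 + (1 - y) * ρ₀)) * (t0 + t1) * (y / (1 - y)) * ((y ^ 2 + (1 - y) * ρb) / (1 - (y ^ 2 + (1 - y) * ρb)))
      = (1 - (y ^ 2 + (1 - y) * ρ₀)) * (t0 + t1) * (y / (1 - y)) * (ρb / (1 - ρb))
        - (1 - (y ^ 2 + (1 - y) * ρ₀)) * (t0 + t1) * (y / (1 - y)) * ((ρb / (1 - ρb) - y / (1 - y)) * y / (1 + y - ρb)) := by rw [eFb]; ring
  linarith only [step1b, step2b, eFb']

set_option maxHeartbeats 2000000 in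
/-- **cell B0 with two heavy rows as a real inequality** (the breakpoint `θ = u/κ₀`): from the chord inequality in `F`-form, the regime facts and
`two_heavy_rows_ineq` (kit j297124): `W t₀ u H_a + W t₁ u H_b + W t₂κ₂u ≤ γ·As·u + γ(1−As)·H_a`. [this work] -/
theorem cell_B0_twoHeavy_real (y t0 t1 t2 ρ₀ ρa ρb κ2 As : ℝ) (hy0 : 0 < y) (hy1 : y < 1) (h1y : 0 < 1 - y) (hyt2 : y ≤ t2)
    (ht0p : 0 ≤ t0) (ht1p : 0 ≤ t1) (hts : t0 + t1 + t2 = 1) (hρ₀y : ρ₀ < y) (hρay : y < ρa) (hρa1 : ρa < 1) (hρby : y < ρb) (hρb1 : ρb < 1)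
    (hρba : ρb ≤ ρa) (hF1 : ρa * (1 + t0) ≤ 2 * ρ₀) (hF2 : ρb * (2 - t2) ≤ 2 * ρ₀) (_hPs : y ≤ 1 - As) (hAs : t2 ≤ 1 - As) (hρ₀0 : 0 ≤ ρ₀)
    (hP2 : (1 - (y ^ 2 + (1 - y) * ρ₀)) * (t0 * ((y ^ 2 + (1 - y) * ρa) / (1 - (y ^ 2 + (1 - y) * ρa)))
      + t1 * ((y ^ 2 + (1 - y) * ρb) / (1 - (y ^ 2 + (1 - y) * ρb))) + t2 * κ2) ≤ y ^ 2 + (1 - y) * ρ₀) :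
    (1 - (y ^ 2 + (1 - y) * ρ₀)) * t0 * (y / (1 - y)) * (ρa / (1 - ρa))
      + (1 - (y ^ 2 + (1 - y) * ρ₀)) * t1 * (ρb / (1 - ρb)) * (y / (1 - y))
      + (1 - (y ^ 2 + (1 - y) * ρ₀)) * t2 * κ2 * (y / (1 - y))
      ≤ (y ^ 2 + (1 - y) * ρ₀) * As * (y / (1 - y)) + (y ^ 2 + (1 - y) * ρ₀) * (1 - As) * (ρa / (1 - ρa)) := by
  have hza : 0 < 1 + y - ρa := by linarith only [hρa1, hy0]
  have hzb' : 0 < 1 + y - ρb := by linarith only [hρb1, hy0]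
  have hzst : 0 < 1 + y - ρ₀ := by linarith
  have eγ1 : 1 - (y ^ 2 + (1 - y) * ρ₀) = (1 - y) * (1 + y - ρ₀) := by ring
  have hγ1 : 0 ≤ 1 - (y ^ 2 + (1 - y) * ρ₀) := by rw [eγ1]; positivity
  have hρa1' : 0 < 1 - ρa := by linarith only [hρa1]
  have hρb1' : 0 < 1 - ρb := by linarith only [hρb1]
  have huκa : y / (1 - y) ≤ ρa / (1 - ρa) := by rw [div_le_div_iff₀ h1y hρa1']; linarith only [hρay, hy1, hρa1]
  have huHb : y / (1 - y) ≤ ρb / (1 - ρb) := by rw [div_le_div_iff₀ h1y hρb1']; linarith only [hρby, hy1, hρb1]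
  have hu0 : 0 ≤ y / (1 - y) := div_nonneg hy0.le h1y.le
  have Wu : (1 - (y ^ 2 + (1 - y) * ρ₀)) * (y / (1 - y)) = y * (1 + y - ρ₀) := by rw [eγ1]; field_simp
  have eFa : (y ^ 2 + (1 - y) * ρa) / (1 - (y ^ 2 + (1 - y) * ρa)) = ρa / (1 - ρa) - (ρa / (1 - ρa) - y / (1 - y)) * y / (1 + y - ρa) := by
    have e1 : 1 - (y ^ 2 + (1 - y) * ρa) = (1 - y) * (1 + y - ρa) := by ring
    rw [e1]; field_simp; ring
  have eFb : (y ^ 2 + (1 - y) * ρb) / (1 - (y ^ 2 + (1 - y) * ρb)) = ρb / (1 - ρb) - (ρb / (1 - ρb) - y / (1 - y)) * y / (1 + y - ρb) := by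
    have e1 : 1 - (y ^ 2 + (1 - y) * ρb) = (1 - y) * (1 + y - ρb) := by ring
    rw [e1]; field_simp; ring
  have eDa : ρa / (1 - ρa) - y / (1 - y) = (ρa - y) / ((1 - ρa) * (1 - y)) := by field_simp; ring
  have eDb : ρb / (1 - ρb) - y / (1 - y) = (ρb - y) / ((1 - ρb) * (1 - y)) := by field_simp; ring
  have hDa : 0 ≤ ρa / (1 - ρa) - y / (1 - y) := by linarith only [huκa]
  have hDb : 0 ≤ ρb / (1 - ρb) - y / (1 - y) := by linarith only [huHb]
  have c3 := GluedWindow.two_heavy_rows_ineq y t0 t1 t2 (1 - As) ρ₀ ρa ρb hy0.le hy1.le hyt2 hAs ht0p ht1p hts hρby.le hρba hρa1.le hF1 hF2 hρ₀0 hρ₀y.le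
  have hday : 0 < ρa - y := by linarith only [hρay]
  have hμ : (ρb / (1 - ρb) - y / (1 - y)) / (1 + y - ρb) ≤ ((ρb - y) / (ρa - y)) * ((ρa / (1 - ρa) - y / (1 - y)) / (1 + y - ρa)) := by
    rw [eDa, eDb]
    have e1 : (ρb - y) / (ρa - y) * ((ρa - y) / ((1 - ρa) * (1 - y)) / (1 + y - ρa)) = (ρb - y) / ((1 - ρa) * (1 - y) * (1 + y - ρa)) := by
      field_simp
    have e2 : (ρb - y) / ((1 - ρb) * (1 - y)) / (1 + y - ρb) = (ρb - y) / ((1 - ρb) * (1 - y) * (1 + y - ρb)) := by rw [div_div]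
    rw [e1, e2]
    refine div_le_div_of_nonneg_left (by linarith only [hρby]) (by positivity) ?_
    have a1 : (1 - ρa) * (1 + y - ρa) ≤ (1 - ρb) * (1 + y - ρb) := by nlinarith only [hρba, hρa1, hy0, hρb1, hza]
    nlinarith only [a1, h1y]
  have key : y ^ 2 * (1 + y - ρ₀) * (t0 * ((ρa / (1 - ρa) - y / (1 - y)) / (1 + y - ρa)) + t1 * ((ρb / (1 - ρb) - y / (1 - y)) / (1 + y - ρb)))
      ≤ (1 - As) * (y ^ 2 + (1 - y) * ρ₀) * (ρa / (1 - ρa) - y / (1 - y)) := by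
    have s1 := mul_le_mul_of_nonneg_left hμ ht1p
    have hyz : 0 ≤ y ^ 2 * (1 + y - ρ₀) := mul_nonneg (sq_nonneg y) hzst.le
    have s2 : y ^ 2 * (1 + y - ρ₀) * (t0 * ((ρa / (1 - ρa) - y / (1 - y)) / (1 + y - ρa)) + t1 * ((ρb - y) / (ρa - y) * ((ρa / (1 - ρa) - y / (1 - y)) / (1 + y - ρa))))
        = ((t0 * (ρa - y) + t1 * (ρb - y)) * y ^ 2 * (1 + y - ρ₀)) * ((ρa / (1 - ρa) - y / (1 - y)) / ((1 + y - ρa) * (ρa - y))) := by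
      field_simp
    have s3 := mul_le_mul_of_nonneg_right c3 (div_nonneg hDa (mul_pos hza hday).le)
    have s4 : (1 - As) * (y ^ 2 + (1 - y) * ρ₀) * (1 + y - ρa) * (ρa - y) * ((ρa / (1 - ρa) - y / (1 - y)) / ((1 + y - ρa) * (ρa - y)))
        = (1 - As) * (y ^ 2 + (1 - y) * ρ₀) * (ρa / (1 - ρa) - y / (1 - y)) := by
      field_simp
    nlinarith only [s1, s2, s3, s4, hyz]
  have step1a := mul_le_mul_of_nonneg_right hP2 hu0
  rw [eFa, eFb] at step1a
  have corr : (1 - (y ^ 2 + (1 - y) * ρ₀)) * (y / (1 - y)) * (t0 * ((ρa / (1 - ρa) - y / (1 - y)) * y / (1 + y - ρa)) + t1 * ((ρb / (1 - ρb) - y / (1 - y)) * y / (1 + y - ρb)))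
      ≤ (y ^ 2 + (1 - y) * ρ₀) * (1 - As) * (ρa / (1 - ρa) - y / (1 - y)) := by
    have e1 : (1 - (y ^ 2 + (1 - y) * ρ₀)) * (y / (1 - y)) * (t0 * ((ρa / (1 - ρa) - y / (1 - y)) * y / (1 + y - ρa)) + t1 * ((ρb / (1 - ρb) - y / (1 - y)) * y / (1 + y - ρb)))
        = y ^ 2 * (1 + y - ρ₀) * (t0 * ((ρa / (1 - ρa) - y / (1 - y)) / (1 + y - ρa)) + t1 * ((ρb / (1 - ρb) - y / (1 - y)) / (1 + y - ρb))) := by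
      rw [Wu]; ring
    rw [e1]; linarith only [key]
  nlinarith only [step1a, corr]

end GluedWindow
end LawDec
end Quant
end Summit.CriticalPhenomena.PercolationContinuityZ3.Theorems
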